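import Literature.AlgebraicGeometry.Resolution.Blowups
import Literature.AlgebraicGeometry.Resolution.BlowupsExistence
import Literature.AlgebraicGeometry.Resolution.BlowupsLocal
import Literature.AlgebraicGeometry.Resolution.BlowupsFlatBaseChange
import Literature.AlgebraicGeometry.Resolution.Temkin2008Localization
import HarnessLib

/-!
# Crux `AffineToGlobal` (stmt-ResolutionOfSingularities-15961), line `birth`, stub
# `stub_localModel`: one-shot ideals pass to blow-ups of flat pro-open subschemes of the base

Route `ResolutionOfSingularities/SectionAscent`, crux `AffineToGlobal`, line `birth`; support
file (`--supports stmt-ResolutionOfSingularities-15961`) landing the registered stub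
`stub_localModel` of the lead's skeleton `Cruxes/AffineToGlobal/Lines/birth.lean` with exactly
its registered signature.

**Statement.** Let `π : W ⟶ B` be a blow-up of `B` along an ideal sheaf `J₀`, let `J` be an
ideal sheaf on `W` co-supported in the non-regular locus of `W` such that every blow-up of `W`
along `J` is a regular scheme, and let `ℓ : S ⟶ B` be a flat preimmersion (the model case is
the localization `Spec 𝒪_{X,x} ⟶ Spec Γ(X, U)`). Then every blow-up `g : S' ⟶ S` of `S` along
`ℓ⁻¹J₀ 𝒪_S` admits a desingularization in Temkin's sense (`Scheme.AdmitsDesingularization`: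
a blow-up of `S'` along an ideal sheaf co-supported in the singular locus, with regular source).

**Proof** (pure blow-up calculus, Görtz–Wedhorn I Prop. 13.91 (2) and Temkin 2008 §2.1).
`W ×_B S ⟶ S` is a blow-up along `ℓ⁻¹J₀` (blow-ups commute with flat base change,
`IsBlowup.pullback_snd_of_flat`), hence isomorphic to `S'` over `S` (`IsBlowup.unique`). Blow
`W ×_B S` up along `fst⁻¹J` (`exists_isBlowup`); the result is isomorphic to
`Bl_J W ×_W (W ×_B S)` (flat base change along the flat projection `fst`, uniqueness), whose
points have the local rings of the regular scheme `Bl_J W`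
(`mem_regularLocus_iff_of_flat_of_isPreimmersion`: `fst` and its base changes are flat
preimmersions, and so are isomorphisms). The centre `fst⁻¹J` is co-supported in the non-regular
locus of `W ×_B S` by the same identification of local rings; finally everything is transported
along `W ×_B S ≅ S'` (`IsBlowup.comp_iso`).

No new definitions; no named facts are used. Sources: U. Görtz, T. Wedhorn, *Algebraic
Geometry I*, 2nd ed. (2020), Prop. 13.91 (2) [GortzWedhorn2020]; M. Temkin, *Desingularization
of quasi-excellent schemes in characteristic zero*, Adv. Math. 219 (2008), §2.1 (p. 6–7)
[Temkin2008].
-/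

noncomputable section

set_option linter.dupNamespace false -- mandated namespace of this single-conjunct summit

open CategoryTheory CategoryTheory.Limits AlgebraicGeometry Literature.AlgebraicGeometry.Resolution

namespace Summit.ResolutionOfSingularities.ResolutionOfSingularities.Theorems.AffineToGlobal.LocalModel

/-- **Regularity transports along a flat preimmersion onto a regular scheme**: if `f : X ⟶ Y`
is a flat preimmersion (e.g. an isomorphism, or a base change of `Spec 𝒪_{X,x} ⟶ X`) and `Y` is
regular, then `X` is regular — the local rings of `X` are local rings of `Y`
(`mem_regularLocus_iff_of_flat_of_isPreimmersion`). [cite: Temkin2008, §2.1 (p. 6)] -/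
theorem isRegular_of_flat_of_isPreimmersion {X Y : Scheme.{0}} (f : X ⟶ Y) [Flat f]
    [IsPreimmersion f] (hY : Scheme.IsRegular Y) : Scheme.IsRegular X := fun x =>
  (Scheme.mem_regularLocus x).mp <| (mem_regularLocus_iff_of_flat_of_isPreimmersion f x).mpr <|
    (Scheme.mem_regularLocus _).mpr (hY _)

/-- **Desingularizations transport along isomorphisms**: if `X` admits a desingularization and
`X ≅ Y`, then `Y` admits a desingularization (the same blow-up composed with the isomorphism,
`IsBlowup.comp_iso`; its centre is moved along the isomorphism, which identifies local rings).
[folklore] -/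
theorem admitsDesingularization_of_iso {X Y : Scheme.{0}} (e : X ≅ Y)
    (h : Scheme.AdmitsDesingularization X) : Scheme.AdmitsDesingularization Y := by
  obtain ⟨X', ρ, ⟨I, hρ, hI⟩, hX'⟩ := h
  refine ⟨X', ρ ≫ e.hom, ⟨I.comap e.inv, hρ.comp_iso e, fun y hy hyreg => ?_⟩, hX'⟩
  have hy' : e.inv y ∈ (I.support : Set X) := by
    rw [Scheme.IdealSheafData.support_comap, TopologicalSpace.Closeds.coe_preimage] at hy
    exact hy
  exact hI hy' ((mem_regularLocus_iff_of_flat_of_isPreimmersion e.inv y).mp hyreg)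

/-- **One-shot ideals pass to flat pro-open base changes** (pure blow-up calculus): if
`π : W ⟶ B` is a blow-up along `J₀`, `J` is an ideal sheaf on `W` co-supported in the
non-regular locus all of whose blow-ups are regular, and `ℓ : S ⟶ B` is a flat preimmersion,
then every blow-up `S'` of `S` along `ℓ⁻¹J₀ 𝒪_S` admits a desingularization: `S' ≅ W ×_B S`
over `S` (blow-ups commute with flat base change, uniqueness of blow-ups); the blow-up of
`W ×_B S` along `fst⁻¹J` is `≅ Bl_J W ×_W (W ×_B S)` (flat base change again), whose local
rings are local rings of the regular `Bl_J W` (flat preimmersions identify local rings), and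
its centre `fst⁻¹J` lies in the non-regular locus of `W ×_B S` for the same reason.
[cite: GortzWedhorn2020, Prop. 13.91 (2)] -/
theorem admitsDesingularization_pullback (B S : Scheme.{0}) (ℓ : S ⟶ B) [Flat ℓ]
    [IsPreimmersion ℓ] (W : Scheme.{0}) (π : W ⟶ B) (J : W.IdealSheafData)
    (hsupp : ∀ w : W, w ∈ J.support → ¬ IsRegularLocalRing (W.presheaf.stalk w))
    (hreg : ∀ (W' : Scheme.{0}) (ρ : W' ⟶ W), IsBlowup ρ J → Scheme.IsRegular W') :
    Scheme.AdmitsDesingularization (pullback π ℓ) := by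
  -- blow `W ×_B S` up along `fst⁻¹J`
  obtain ⟨P', ρ, hρ⟩ := exists_isBlowup (pullback π ℓ) (J.comap (pullback.fst π ℓ))
  -- `P'` is regular: it is `Bl_J W ×_W (W ×_B S)`, a flat preimmersion into the regular `Bl_J W`
  obtain ⟨W', π', hπ'⟩ := exists_isBlowup W J
  have hW'reg : Scheme.IsRegular W' := hreg W' π' hπ'
  have hρ' : IsBlowup (pullback.snd π' (pullback.fst π ℓ)) (J.comap (pullback.fst π ℓ)) :=
    hπ'.pullback_snd_of_flat (pullback.fst π ℓ)
  obtain ⟨e', -, -⟩ := hρ'.unique hρ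
  have hP'reg : Scheme.IsRegular P' :=
    isRegular_of_flat_of_isPreimmersion e'.inv
      (isRegular_of_flat_of_isPreimmersion (pullback.fst π' (pullback.fst π ℓ)) hW'reg)
  -- the centre lies in the non-regular locus of `W ×_B S`
  refine ⟨P', ρ, ⟨J.comap (pullback.fst π ℓ), hρ, fun s hs hsreg => ?_⟩, hP'reg⟩
  have hs' : pullback.fst π ℓ s ∈ J.support := by
    rw [Scheme.IdealSheafData.support_comap, TopologicalSpace.Closeds.coe_preimage] at hs
    exact hs
  exact hsupp _ hs' <| (Scheme.mem_regularLocus _).mp <|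
    (mem_regularLocus_iff_of_flat_of_isPreimmersion (pullback.fst π ℓ) s).mp hsreg

/-- **STUB `stub_localModel` of crux `AffineToGlobal` (stmt-ResolutionOfSingularities-15961),
line `birth`: one-shots pass to flat pro-open base changes.** If `π : W ⟶ B` is a blow-up
along `J₀`, `J` an ideal sheaf on `W` co-supported in the non-regular locus all of whose
blow-ups are regular, and `ℓ : S ⟶ B` a flat preimmersion, then every blow-up `g : S' ⟶ S` of
`S` along `ℓ⁻¹J₀ 𝒪_S` admits a desingularization. Proof: `W ×_B S ⟶ S` is a blow-up along
`ℓ⁻¹J₀` (`IsBlowup.pullback_snd_of_flat`, Görtz–Wedhorn I Prop. 13.91 (2)), hence `≅ S'`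
over `S` (`IsBlowup.unique`); `W ×_B S` admits a desingularization
(`admitsDesingularization_pullback`), which transports along the isomorphism
(`admitsDesingularization_of_iso`). [cite: GortzWedhorn2020, Prop. 13.91 (2)] -/
theorem stub_localModel (B S : Scheme.{0}) (ℓ : S ⟶ B) [Flat ℓ] [IsPreimmersion ℓ]
    (W : Scheme.{0}) (π : W ⟶ B) (J₀ : B.IdealSheafData) (hπ : IsBlowup π J₀)
    (J : W.IdealSheafData)
    (hsupp : ∀ w : W, w ∈ J.support → ¬ IsRegularLocalRing (W.presheaf.stalk w))
    (hreg : ∀ (W' : Scheme.{0}) (ρ : W' ⟶ W), IsBlowup ρ J → Scheme.IsRegular W')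
    (S' : Scheme.{0}) (g : S' ⟶ S) (hg : IsBlowup g (J₀.comap ℓ)) :
    Scheme.AdmitsDesingularization S' := by
  -- `W ×_B S ⟶ S` is a blow-up of `S` along `ℓ⁻¹J₀`, hence isomorphic to `S'` over `S`
  obtain ⟨e, -, -⟩ := (hπ.pullback_snd_of_flat ℓ).unique hg
  exact admitsDesingularization_of_iso e
    (admitsDesingularization_pullback B S ℓ W π J hsupp hreg)

end Summit.ResolutionOfSingularities.ResolutionOfSingularities.Theorems.AffineToGlobal.LocalModel

end
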